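import Summits.MatrixMultiplication.OmegaCensus.LocalUSPOmegaBound
import Summits.MatrixMultiplication.OmegaCensus.LocalUSPChartBound

/-!
# ω-census, family (b1): kernel row for a 18-row local USP of width 8 (eng1 usp v4 object, 2026-08-20)

HONEST FRAMING (pub-omega census; verbatim): lottery ticket; floor = certified bounds/negative ranges.
Census bookkeeping, not progress on `ω` (tree: `ω < 2.373`).  Sibling of `LocalUSPInstancesK789.lean` / `LocalUSPInstancesK9*.lean`
(group seat: largest puzzles found by the SAT census) and `LocalUSPInstanceW8U17.lean` (ENG1).  The ENG1 seat's exact search (eng1 `usp4`: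
composition-ordered forced roots, root-stabiliser pruning, clique search) met the 18-row local USP of width 8 below (symbols `1,2,3`
coded `0,1,2`), re-verified from the definition by two independent checkers before this file was cut.  Proof shape as in the sibling files:
`decide` (pattern property of the explicit puzzle) + `decide +kernel` (one integer inequality) + `omega_le_div_of_isLocalUSP` (CKSU 2005, tree-proved).
Maximality of 18 at width 8 is NOT claimed here.
-/

noncomputable section

open Literature.Computability.AlgebraicComplexity

namespace Summit.MatrixMultiplication.OmegaCensus

-- one-off (as in the sibling `LocalUSPInstancesK9U.lean`): the 18×8 pattern check (5832 ordered triples) exceeds the default budget of one `decide +kernel`;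
-- it is split per first row (`fin_cases`) so that each kernel evaluation stays small
set_option maxHeartbeats 1000000 in
/-- Census row (b1-U) `w8_s18`: the local USP `{11122233 11312223 21321321 11231232 23211312 13232121 23112213 23311221 13221132 32132121 21223311 31122312 31212132 22233111 32113122 22123113 21131322 12321231}` (18 rows, width 8; pattern set `L ∪ {123}`;
found by the ENG1 exact search eng1 `usp4` on 2026-08-20; maximality at width 8 not claimed) through the CW chart with modulus `m = 23` certifies
`ω ≤ 2.7337 = 27337/10000` (integer certificate `23^240000 ≤ 18^30000·21^218696`, tight in the last digit: the exponent `27336·8` fails;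
exact value of the row `3(8 log 23 − log 18)/(8 log 21)`). [cite: CohnKleinbergSzegedyUmans2005, Thm. 37 and §6.3] -/
theorem omega_le_of_localUSP_w8_s18 : omega ℂ ≤ 2.7337 := by
  have h := omega_le_div_of_isLocalUSP (row := ![![0, 0, 0, 1, 1, 1, 2, 2], ![0, 0, 2, 0, 1, 1, 1, 2], ![1, 0, 2, 1, 0, 2, 1, 0], ![0, 0, 1, 2, 0, 1, 2, 1], ![1, 2, 1, 0, 0, 2, 0, 1], ![0, 2, 1, 2, 1, 0, 1, 0], ![1, 2, 0, 0, 1, 1, 0, 2], ![1, 2, 2, 0, 0, 1, 1, 0], ![0, 2, 1, 1, 0, 0, 2, 1], ![2, 1, 0, 2, 1, 0, 1, 0], ![1, 0, 1, 1, 2, 2, 0, 0], ![2, 0, 0, 1, 1, 2, 0, 1], ![2, 0, 1, 0, 1, 0, 2, 1], ![1, 1, 1, 2, 2, 0, 0, 0], ![2, 1, 0, 0, 2, 0, 1, 1], ![1, 1, 0, 1, 2, 0, 0, 2], ![1, 0, 0, 2, 0, 2, 1, 1], ![0, 1, 2, 1, 0, 1, 2, 0]])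
    (by unfold localStrongUSPPatterns; intro a; fin_cases a <;> decide +kernel) (by norm_num) (by norm_num)
    (m := 23) (by norm_num) (a := 27337) (b := 10000) (by norm_num) (by decide +kernel)
  have e : ((27337 : ℕ) : ℝ) / ((10000 : ℕ) : ℝ) = 2.7337 := by norm_num
  rwa [e] at h

end Summit.MatrixMultiplication.OmegaCensus

end
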